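import Summits.NavierStokesRegularity.NavierStokesRegularity.Theorems.SqueezeCycleRecurrentBridge
import Summits.NavierStokesRegularity.NavierStokesRegularity.Theorems.SqueezeCycleSingularProfileOfNontrivial
import Summits.NavierStokesRegularity.NavierStokesRegularity.Theses.RecurrentProfiles
import Summits.NavierStokesRegularity.NavierStokesRegularity.Theorems.SqueezeCycleApexLocalisationKNSSForm
import HarnessLib

/-!
# Route `SqueezeCycle` — crux `ExtremalBiaxialitySubcritical` (stmt-NavierStokesRegularity-11609)
# from `RecurrentLiouville` (stmt-NavierStokesRegularity-1589) ALONE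

Line `recurrent-singular-bridge` (Cruxes/ExtremalBiaxialitySubcritical/Lines/recurrent_singular_bridge.lean),
lead prover-line-stmt-NavierStokesRegularity-11609-c1-0, 2026-08-17. The line's first stub
`SingularProfileOfNontrivial` (item stmt-NavierStokesRegularity-15368) is PROVED
(`squeezeCycle_singularProfileOfNontrivial_proof`), and the glue `RecurrentBridge` (item
stmt-NavierStokesRegularity-15364) is PROVED (`recurrentBridge_term_proof`). Composing the two, the
crux — and the route TARGET `SqueezeLiouville` — now follow from the single open item
`RecurrentLiouville` (stmt-NavierStokesRegularity-1589), stated against EITHER of its two route decls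
(`Theses.SqueezeCycle.RecurrentLiouville`, `Theses.RecurrentProfiles.RecurrentLiouville`; same body,
`Iff.rfl`):

* `squeezeLiouville_of_recurrentLiouville       : RecurrentLiouville → SqueezeLiouville`;
* `extremalBiaxialitySubcritical_of_recurrentLiouville : RecurrentLiouville → ExtremalBiaxialitySubcritical`;
* `recurrentProfiles_recurrentLiouville_iff` and the `…_of_recurrentProfiles_recurrentLiouville` forms
  (the registered stub of the line is typed by the RecurrentProfiles decl).

So the day item 1589 lands with proof `h`, `extremalBiaxialitySubcritical_of_recurrentLiouville h`
closes item 11609 (type = the route decl verbatim).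

## References

* D. Albritton, T. Barker, J. Math. Fluid Mech. 21 (2019), no. 43 = arXiv:1811.00502, Thm 1.1, §3.
  [AlbrittonBarker2019]
* H. Furstenberg, *Recurrence in Ergodic Theory and Combinatorial Number Theory* (1981), Thm 1.16.
  [Furstenberg1981]
* G. Koch, N. Nadirashvili, G. Seregin, V. Šverák, Acta Math. 203 (2009). [KNSS2009]
-/

noncomputable section

-- the sub-problem namespace repeats the summit name (D-0017 layout `Summit.<S>.<P>.Theorems`)
set_option linter.dupNamespace false

namespace Summit.NavierStokesRegularity.NavierStokesRegularity.Theorems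

open Summit.NavierStokesRegularity.NavierStokesRegularity.Theses

/-- **Route target from item 1589 alone.** `RecurrentLiouville` implies `SqueezeLiouville`
(Type-I Liouville on the KNSS-mild class `𝒦_C`): the other hypothesis of
`squeezeLiouville_of_singularProfile_of_recurrentLiouville`, `SingularProfileOfNontrivial`
(Albritton–Barker 2019 Thm 1.1, reverse direction, inside `𝒦_C`), is the tree theorem
`squeezeCycle_singularProfileOfNontrivial_proof`.
[cite: AlbrittonBarker2019, Thm 1.1 and §3] [cite: Furstenberg1981, Thm 1.16] -/
theorem squeezeLiouville_of_recurrentLiouville : Summit.NavierStokesRegularity.NavierStokesRegularity.Theses.SqueezeCycle.RecurrentLiouville → Summit.NavierStokesRegularity.NavierStokesRegularity.Theses.SqueezeCycle.SqueezeLiouville :=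
  fun hR =>
    squeezeLiouville_of_singularProfile_of_recurrentLiouville
      squeezeCycle_singularProfileOfNontrivial_proof hR

/-- **The crux from item 1589 alone.** `RecurrentLiouville` (stmt-NavierStokesRegularity-1589)
implies `ExtremalBiaxialitySubcritical` (stmt-NavierStokesRegularity-11609): the proved glue
`recurrentBridge_term_proof` fed with the proved first stub
`squeezeCycle_singularProfileOfNontrivial_proof`. This is the composition
`ExtremalBiaxialitySubcritical_of` of line `recurrent-singular-bridge` with its one open stub as a
hypothesis. [cite: AlbrittonBarker2019, Thm 1.1 and §3] -/
theorem extremalBiaxialitySubcritical_of_recurrentLiouville : Summit.NavierStokesRegularity.NavierStokesRegularity.Theses.SqueezeCycle.RecurrentLiouville → Summit.NavierStokesRegularity.NavierStokesRegularity.Theses.SqueezeCycle.ExtremalBiaxialitySubcritical :=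
  fun hR => recurrentBridge_term_proof squeezeCycle_singularProfileOfNontrivial_proof hR

/-- The two route decls of the shared item stmt-NavierStokesRegularity-1589 have the same body:
`RecurrentProfiles.RecurrentLiouville ↔ SqueezeCycle.RecurrentLiouville` definitionally. [folklore] -/
theorem recurrentProfiles_recurrentLiouville_iff :
    RecurrentProfiles.RecurrentLiouville ↔ SqueezeCycle.RecurrentLiouville :=
  Iff.rfl

/-- Route target from the RecurrentProfiles spelling of item 1589 (the type of the registered stub
`stub_recurrentLiouville` of line `recurrent-singular-bridge`).
[cite: AlbrittonBarker2019, Thm 1.1 and §3] -/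
theorem squeezeLiouville_of_recurrentProfiles_recurrentLiouville
    (hR : RecurrentProfiles.RecurrentLiouville) : SqueezeCycle.SqueezeLiouville :=
  squeezeLiouville_of_recurrentLiouville (recurrentProfiles_recurrentLiouville_iff.1 hR)

/-- The crux from the RecurrentProfiles spelling of item 1589 (the type of the registered stub
`stub_recurrentLiouville` of line `recurrent-singular-bridge`): literally the line's composition
`ExtremalBiaxialitySubcritical_of` with its single open stub abstracted.
[cite: AlbrittonBarker2019, Thm 1.1 and §3] -/
theorem extremalBiaxialitySubcritical_of_recurrentProfiles_recurrentLiouville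
    (hR : RecurrentProfiles.RecurrentLiouville) : SqueezeCycle.ExtremalBiaxialitySubcritical :=
  extremalBiaxialitySubcritical_of_recurrentLiouville (recurrentProfiles_recurrentLiouville_iff.1 hR)

/-! ## The crux from the route's own two open children (appended 2026-08-17, lead c1)

Item 1589 is certified equivalent to the pair of RellichScar items 11716 `NoApexTypeIProfile` and
11719 `ApexLocalisation` (`recurrentLiouville_iff_rellichScar`), both rendered since route rev 10 as
decls of `Theses/SqueezeCycle.lean` with verbatim bodies (tree: `NoApexKNSS.noApexTypeIProfile_iff_rellichScar`,
`NoApexKNSS.apexLocalisation_iff_rellichScar`). Hence the crux — and the route target — follow from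
those two children directly. -/

/-- Item 1589 from the route's own children 11716 and 11719 (SqueezeCycle spellings):
apex localisation upgrades an origin-singular rate profile to an apex-class one, which the apex
Type-I Liouville statement excludes (`recurrentLiouville_of_rellichScar`). [cite: KNSS2009, (1.6)] -/
theorem recurrentLiouville_of_noApexTypeIProfile_of_apexLocalisation
    (hX : SqueezeCycle.NoApexTypeIProfile) (hA : SqueezeCycle.ApexLocalisation) :
    SqueezeCycle.RecurrentLiouville :=
  recurrentLiouville_of_rellichScar (NoApexKNSS.noApexTypeIProfile_iff_rellichScar.1 hX)
    (NoApexKNSS.apexLocalisation_iff_rellichScar.1 hA)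

/-- **The crux from the route's own two open children.** `NoApexTypeIProfile` (stmt-11716) and
`ApexLocalisation` (stmt-11719) imply `ExtremalBiaxialitySubcritical` (stmt-11609): children ⇒
`RecurrentLiouville` (1589, `recurrentLiouville_of_rellichScar`) ⇒ crux
(`extremalBiaxialitySubcritical_of_recurrentLiouville`). Registered stub
`extremalBiaxialitySubcritical_of_rellichScar` of line `recurrent-singular-bridge`.
[cite: KNSS2009, (1.6)] [cite: AlbrittonBarker2019, Thm 1.1 and §3] -/
theorem extremalBiaxialitySubcritical_of_rellichScar : Summit.NavierStokesRegularity.NavierStokesRegularity.Theses.SqueezeCycle.NoApexTypeIProfile → Summit.NavierStokesRegularity.NavierStokesRegularity.Theses.SqueezeCycle.ApexLocalisation → Summit.NavierStokesRegularity.NavierStokesRegularity.Theses.SqueezeCycle.ExtremalBiaxialitySubcritical :=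
  fun hX hA =>
    extremalBiaxialitySubcritical_of_recurrentLiouville
      (recurrentLiouville_of_noApexTypeIProfile_of_apexLocalisation hX hA)

/-- The route target from the route's own two open children 11716 and 11719.
[cite: KNSS2009, (1.6)] [cite: AlbrittonBarker2019, Thm 1.1 and §3] -/
theorem squeezeLiouville_of_rellichScar (hX : SqueezeCycle.NoApexTypeIProfile)
    (hA : SqueezeCycle.ApexLocalisation) : SqueezeCycle.SqueezeLiouville :=
  squeezeLiouville_of_recurrentLiouville
    (recurrentLiouville_of_noApexTypeIProfile_of_apexLocalisation hX hA)

end Summit.NavierStokesRegularity.NavierStokesRegularity.Theorems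

end
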